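import Mathlib
import HarnessLib
import Summits.HubbardSuperconductivity.HubbardSuperconductivity.Theorems.KLProgrammeKLRegimeEngineV8TowerExports
import Summits.HubbardSuperconductivity.HubbardSuperconductivity.Theorems.KLProgrammeKLRegimeEngineV8Raise
import Summits.HubbardSuperconductivity.HubbardSuperconductivity.Theorems.KLProgrammeKLRegimeEngineV8DefsU10
import Summits.HubbardSuperconductivity.HubbardSuperconductivity.Theorems.KLProgrammeKLRegimeEngineV8DefsL4
import Summits.HubbardSuperconductivity.HubbardSuperconductivity.Theorems.KLProgrammeKLRegimeEngineV8E5PointAugment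

/-!
# Route `KLProgramme` — ENGINE child gen 8 (stmt-HubbardSuperconductivity-20437 `KLRegimeEngineV17F2`), SKELETON v2 class #1, SUCCESSOR MODULE
# of `…EngineV8TowerExports` (plan g18 (R55)/(R55c) sheet rev 1.2 §J: J1 successor with NEW names, J3 F* inside, J4 (k1), J5 MIXED rows;
# gate fact `theorems.append-only` KL STATUS 2026-08-27 l.3326; cell gate-hubbard-kl, seat p5 g8 = class-#1 text owner)

NAME MAP (old ↦ new, J1): `LevelsUExportAt ↦ LevelsUExportMixedAt` (token #18/#21) · `LevelsUStep ↦ LevelsUStep2` · `IsExportPkg ↦ IsExportPkg2` ·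
`klExportPkg ↦ klExportPkg2` · `klCU ↦ klCU2` · `klCUA ↦ klCUA2` · `klCUu ↦ klCUu2` (token #20; threshold now `EngConsts → ℝ → ℝ`, read at the whole raised
package).  The landed module stays (its decls are imported and reused: `LevelsUAt`, `IsGeomTable`, `LevelsUAt.mono`, …); nothing there is edited.

WHAT CHANGES AND WHY.
* §1 **MIXED rows** (FINDING (E5-LABELS), cure (α), ruled (R53)/J5): the E.5 witness of class #3 reads the vertex level norms w.r.t. the POINT-AUGMENTED
  thin family `pointAugment (klAnisoFamily … j) e` (`…EngineV8E5PointAugment`): output legs prescribed by a thin sector OR by a point (fixed momentum).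
  `LevelsUMixedAt L M c P β U μ K j` = the clauses of `LevelsUAt` VERBATIM (same table, same currency, same gain `levelGainExp (levelCount Ωe)` — a
  point-prescribed leg counts as prescribed) for that family, for every choice `e : Fin 4 → FreqMomentum L M` of four points, on `prescribedTuples univ Ωe`
  (what the bridge `klE5_tail_le_of_lineData_pointAugment` reads; text posted KL STATUS l.3326 (a)).  The merged export
  `LevelsUExportMixedAt L M c P β U μ n := ∀ j ≤ n, LevelsUAt … (K_n) j ∧ (1 ≤ j → LevelsUMixedAt … (K_n) j)` has the SAME argument list as
  `LevelsUExportAt` (#18 is an identifier swap) and asks the mixed rows at levels `j ≥ 1` ONLY: the witness reads them at level `n − 2 ≥ 1` (steps `n ≥ 3`;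
  steps `n ≤ 2` use the trivial family, `…E5BlockTrivial`, no points), and at level `0` they are NOT a consequence of (E1-v4)₀ (point legs live where
  `Σ_ω F⁽⁰⁾_ω < 1`, i.e. `t > Λ₁`, invisible to `KernelNormsV4`) — so `levelsUExportMixedAt_zero_iff`: at `n = 0` the merged export IS the thin export and
  the scale-0 base is k3c2-p1's `levelsUExportAt_zero_klEng8` ((R55.16): no new scale-0 obligation).
* §2 the SUCCESSOR STEP `LevelsUStep2 P R Q₀ c u` = the sheet's compiled shape `LevelsUStep2T` VERBATIM with the export history/conclusion
  `LevelsUExportMixedAt`: (k1) `∀ Q : EngConsts, Q₀.IsRaiseOf Q →` (history at `G P Q R`; both token tables are raises of `klEngQ7 P R`), door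
  `U ≤ klEngU₀10 P R cc` (#14's landed door; the final door `klEngU₀11 ≤ klEngU₀10`), CE-aware threshold `U ≤ u Q cc`, volume `klEngL₄ P R β U ≤ L` (#16);
  `IsExportPkg2`.
* §3 the SUCCESSOR DEFERRED PACKAGE `klExportPkg2 P R Q₀` with the (P0′)/F* ELSE-DEFAULT = the SCALE-0 package `(fun p => |Q₀.CE|^p, |Q₀.CE|, fun _ _ => 1)`
  (admissible for every `Q₀`; at `Q₀ = klEngQ7 P R` the table `levelsUExportAt_zero_klEng8` is stated for) instead of the zero package; projections
  `klCU2/klCUA2/klCUu2`, unconditional rows `isExportPkg2_klExportPkg2`, `isGeomTable_klCU2`, `klCU2_nonneg`, `klCUA2_nonneg`, `klCUu2_pos`, the `choose_spec`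
  rows `levelsUStep2_klCU2_of_exists/_of`, and the else-branch readers `klExportPkg2_of_not_exists`, `klCU2_of_not_exists`.
CONSUMERS: stub (b) v2 (history binder / conclusion conjunct `LevelsUExportMixedAt L M (klCU2 P R (klEngQ7 P R)) P β U μ ·`), (c)/(e) v2 `hlevU`,
class #3's successor `E5ShareStep2` (export hypothesis), DefsU11 (`klEngU₀11 ≤ klCUu2 P R (klEngQ7 P R) (QT P R) cc`), the scale-0 base
`levelsUExportMixedAt_klCU2_zero` (separate proof module).

Definitions with bodies + bookkeeping; nothing about the model is asserted; nothing asserts superconductivity.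
-/

noncomputable section

namespace Summit.HubbardSuperconductivity.HubbardSuperconductivity.Theorems.KLRegimeSplit

set_option linter.dupNamespace false -- summit = problem name (single-conjunct summit), D-0017

open Real Finset Literature.MathematicalPhysics.QuantumLattice Literature.Probability.LatticeModels
open Literature.MathematicalPhysics.QuantumLattice.FermiRG
open Summit.HubbardSuperconductivity.HubbardSuperconductivity.Theorems.KLProgrammeLegKernels
open Summit.HubbardSuperconductivity.HubbardSuperconductivity.Theorems.DispersionFlow
open Summit.HubbardSuperconductivity.HubbardSuperconductivity.Theorems.EngineV8

/-! ## §1 MIXED rows and the merged export -/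

section Model

variable (L M : ℕ) [NeZero L]

/-- **`LevelsUMixedAt L M c P β U μ K j`** — the MIXED-prescription level norms of the scale-`j` action at frame `K` in U-currency with the table `c`:
for every choice `e` of four point momenta, the clauses of `LevelsUAt` for the point-augmented thin family `pointAugment (klAnisoFamily … j) e`
(legs `< sectorCount j` thin sectors, the last four legs the points) on `prescribedTuples univ Ωe`: the quartic at any prescription without gain,
`≤ c 2 · Klam|U| · 2^j`, and for `p ≥ 3` every prescription `Ωe` of the `2p` legs
`≤ c p · (Klam|U|)^{p−1} · 2^{(3p−5)j} · (2^j)^{−levelGainExp (levelCount Ωe)}` (a point-prescribed leg counts as prescribed). -/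
def LevelsUMixedAt (c : ℕ → ℝ) (P : SplitConsts) (β U μ : ℝ) (K : TrigPolyC4v) (j : ℕ) : Prop :=
  ∀ e : Fin 4 → FreqMomentum L M,
    (∀ Ωe : Fin 4 → Option (SectorLeg (sectorCount j + 4)),
      hubbardSectorKernelNorm L M β (pointAugment (klAnisoFamily L M β μ K klE0 j) e) (prescribedTuples univ Ωe)
        (klEffectiveAction L M β U μ K klE0 j) ≤ c 2 * (P.Klam * |U|) * (2 : ℝ) ^ j) ∧
    ∀ p : ℕ, 3 ≤ p → ∀ Ωe : Fin (2 * p) → Option (SectorLeg (sectorCount j + 4)),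
      hubbardSectorKernelNorm L M β (pointAugment (klAnisoFamily L M β μ K klE0 j) e) (prescribedTuples univ Ωe)
        (klEffectiveAction L M β U μ K klE0 j) ≤
        c p * (P.Klam * |U|) ^ (p - 1) * (2 : ℝ) ^ ((3 * (p : ℤ) - 5) * j) * (((2 : ℝ) ^ j)⁻¹) ^ levelGainExp (levelCount Ωe)

variable [NeZero M]

/-- **`LevelsUExportMixedAt L M c P β U μ n`** — the MERGED export of the one-shot tower at scale `n` (token #18: same argument list as
`LevelsUExportAt`): at every level `j ≤ n` of the flow frame `K_n = klFlowFrameU L M β U μ n` the thin rows `LevelsUAt`, and at every level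
`1 ≤ j ≤ n` the mixed rows `LevelsUMixedAt` (never asked at level `0`). -/
def LevelsUExportMixedAt (c : ℕ → ℝ) (P : SplitConsts) (β U μ : ℝ) (n : ℕ) : Prop :=
  ∀ j ≤ n, LevelsUAt L M c P β U μ (klFlowFrameU L M β U μ n) j ∧ (1 ≤ j → LevelsUMixedAt L M c P β U μ (klFlowFrameU L M β U μ n) j)

variable {L M}

omit [NeZero M] in
/-- Table monotonicity of the mixed rows. -/
theorem LevelsUMixedAt.mono {c c' : ℕ → ℝ} {P : SplitConsts} (hK : 0 ≤ P.Klam) {β U μ : ℝ} {K : TrigPolyC4v} {j : ℕ}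
    (h : LevelsUMixedAt L M c P β U μ K j) (hcc : ∀ p, 2 ≤ p → c p ≤ c' p) : LevelsUMixedAt L M c' P β U μ K j := by
  have hKU : (0 : ℝ) ≤ P.Klam * |U| := mul_nonneg hK (abs_nonneg U)
  intro e
  refine ⟨fun Ωe => ((h e).1 Ωe).trans ?_, fun p hp Ωe => ((h e).2 p hp Ωe).trans ?_⟩
  · have h2 : (0 : ℝ) ≤ (2 : ℝ) ^ j := by positivity
    exact mul_le_mul_of_nonneg_right (mul_le_mul_of_nonneg_right (hcc 2 le_rfl) hKU) h2
  · have h1 : (0 : ℝ) ≤ (P.Klam * |U|) ^ (p - 1) := pow_nonneg hKU _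
    have h2 : (0 : ℝ) ≤ (2 : ℝ) ^ ((3 * (p : ℤ) - 5) * j) := zpow_nonneg (by norm_num) _
    have h3 : (0 : ℝ) ≤ (((2 : ℝ) ^ j)⁻¹) ^ levelGainExp (levelCount Ωe) := by positivity
    exact mul_le_mul_of_nonneg_right (mul_le_mul_of_nonneg_right (mul_le_mul_of_nonneg_right (hcc p (by omega)) h1) h2) h3

/-- **The merged export contains the thin export** (`LevelsUExportAt`, the landed predicate). -/
theorem LevelsUExportMixedAt.toLevelsUExportAt {c : ℕ → ℝ} {P : SplitConsts} {β U μ : ℝ} {n : ℕ} (h : LevelsUExportMixedAt L M c P β U μ n) :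
    LevelsUExportAt L M c P β U μ n :=
  fun j hj => (h j hj).1

/-- The thin rows of the merged export at a level `j ≤ n`. -/
theorem LevelsUExportMixedAt.levelsUAt {c : ℕ → ℝ} {P : SplitConsts} {β U μ : ℝ} {n : ℕ} (h : LevelsUExportMixedAt L M c P β U μ n) {j : ℕ}
    (hj : j ≤ n) : LevelsUAt L M c P β U μ (klFlowFrameU L M β U μ n) j :=
  (h j hj).1

/-- The mixed rows of the merged export at a level `1 ≤ j ≤ n`. -/
theorem LevelsUExportMixedAt.levelsUMixedAt {c : ℕ → ℝ} {P : SplitConsts} {β U μ : ℝ} {n : ℕ} (h : LevelsUExportMixedAt L M c P β U μ n) {j : ℕ}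
    (h1 : 1 ≤ j) (hj : j ≤ n) : LevelsUMixedAt L M c P β U μ (klFlowFrameU L M β U μ n) j :=
  (h j hj).2 h1

/-- Assembling the merged export from its two row families. -/
theorem levelsUExportMixedAt_of {c : ℕ → ℝ} {P : SplitConsts} {β U μ : ℝ} {n : ℕ} (h : LevelsUExportAt L M c P β U μ n)
    (hm : ∀ j, 1 ≤ j → j ≤ n → LevelsUMixedAt L M c P β U μ (klFlowFrameU L M β U μ n) j) : LevelsUExportMixedAt L M c P β U μ n :=
  fun j hj => ⟨h j hj, fun h1 => hm j h1 hj⟩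

/-- **At scale `0` the merged export IS the thin export** (the mixed rows are asked at levels `≥ 1` only) — so the scale-0 base of class #1 is
unchanged by J5 ((R55.16)). -/
theorem levelsUExportMixedAt_zero_iff {c : ℕ → ℝ} {P : SplitConsts} {β U μ : ℝ} :
    LevelsUExportMixedAt L M c P β U μ 0 ↔ LevelsUExportAt L M c P β U μ 0 := by
  refine ⟨fun h => h.toLevelsUExportAt, fun h j hj => ⟨h j hj, fun h1 => ?_⟩⟩
  omega

/-- Export monotonicity in the table. -/
theorem LevelsUExportMixedAt.mono {c c' : ℕ → ℝ} {P : SplitConsts} (hK : 0 ≤ P.Klam) {β U μ : ℝ} {n : ℕ}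
    (h : LevelsUExportMixedAt L M c P β U μ n) (hcc : ∀ p, 2 ≤ p → c p ≤ c' p) : LevelsUExportMixedAt L M c' P β U μ n :=
  fun j hj => ⟨(h j hj).1.mono hK hcc, fun h1 => ((h j hj).2 h1).mono hK hcc⟩

end Model

/-! ## §2 The successor step Prop ((R55c) shape `LevelsUStep2T`, export history/conclusion `LevelsUExportMixedAt`) -/

/-- **`LevelsUStep2 P R Q₀ c u`** — the tower's step in U-currency, successor shape: for every geometry package `G` (`G.WF`), every RAISE `Q` of the
key package `Q₀` ((k1): `Q₀.IsRaiseOf Q` — `CR` and `CE` weakly raised, every other row pinned; table A `klEngQ8 P R` and table B′ are raises of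
`klEngQ7 P R`), under the v2 stub binders (`klEngC₃6`, the landed door `klEngU₀10`, `klEngL₄ P R`, `klEngM₃`; `n ≤ nScales β + 1`, `IsKLRegime`) and
below the step's OWN CE-aware threshold `U ≤ u Q cc`: the history at `G P Q R`, the admissibility of `K_n` and the merged exports at every `j < n`
give the merged export at `n`. -/
def LevelsUStep2 (P : SplitConsts) (R : RenConsts) (Q₀ : EngConsts) (c : ℕ → ℝ) (u : EngConsts → ℝ → ℝ) : Prop :=
  ∀ G : GeoConsts, G.WF → ∀ Q : EngConsts, Q₀.IsRaiseOf Q →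
    ∀ cc : ℝ, 0 < cc → cc ≤ klEngC₃6 P R →
      ∀ μ ∈ klWindowC, ∀ U : ℝ, 0 < U → U ≤ klEngU₀10 P R cc → U ≤ u Q cc →
        ∀ β : ℝ, klBetaMin ≤ β → β ≤ Real.exp (cc / U ^ 2) →
          ∀ (L M : ℕ) [NeZero L] [NeZero M], klEngL₄ P R β U ≤ L → klEngM₃ β U L ≤ M →
            ∀ n : ℕ, n ≤ nScales β + 1 → IsKLRegime U cc (-(n : ℤ)) →
              HistP klPredsV17F2 L M G P Q R β U μ 0 n →
                FrameOK R U (nScales β) μ (klFlowFrameU L M β U μ n) →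
                  (∀ j < n, LevelsUExportMixedAt L M c P β U μ j) →
                    LevelsUExportMixedAt L M c P β U μ n

/-- **An admissible successor export package**: a geometric table `c` with ratio `A` and a threshold POSITIVE at every raised package. -/
def IsExportPkg2 (e : (ℕ → ℝ) × ℝ × (EngConsts → ℝ → ℝ)) : Prop := IsGeomTable e.1 e.2.1 ∧ ∀ Q cc, 0 < e.2.2 Q cc

/-- **The scale-0 package `(|Q₀.CE|^p, |Q₀.CE|, 1)` is admissible for EVERY `Q₀`** ((P0′)/F*: the else-default of the successor deferred package). -/
theorem isExportPkg2_scaleZero (Q₀ : EngConsts) : IsExportPkg2 (fun p => |Q₀.CE| ^ p, |Q₀.CE|, fun _ _ => 1) :=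
  ⟨⟨fun p => pow_nonneg (abs_nonneg _) p, abs_nonneg _, fun p _ => by
    show |Q₀.CE| ^ (p + 1) ≤ |Q₀.CE| * |Q₀.CE| ^ p
    rw [pow_succ']⟩, fun _ _ => one_pos⟩

/-! ## §3 The successor deferred package (F* inside) -/

section Deferred

variable (P : SplitConsts) (R : RenConsts) (Q₀ : EngConsts)

/-- The successor deferred export package: SOME admissible `(c, A, u)` for which `LevelsUStep2` holds, if one exists, ELSE the scale-0 package
`(fun p => |Q₀.CE|^p, |Q₀.CE|, fun _ _ => 1)` ((P0′)/F*: so that the scale-0 base holds in BOTH branches). -/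
def klExportPkg2 : (ℕ → ℝ) × ℝ × (EngConsts → ℝ → ℝ) :=
  open scoped Classical in
  if h : ∃ e : (ℕ → ℝ) × ℝ × (EngConsts → ℝ → ℝ), IsExportPkg2 e ∧ LevelsUStep2 P R Q₀ e.1 e.2.2 then Classical.choose h
  else (fun p => |Q₀.CE| ^ p, |Q₀.CE|, fun _ _ => 1)

/-- **The successor deferred U-currency table `klCU2 P R Q₀`** (token #20: `klCU ↦ klCU2`). -/
def klCU2 : ℕ → ℝ := (klExportPkg2 P R Q₀).1

/-- **The successor deferred envelope ratio `klCUA2 P R Q₀`**. -/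
def klCUA2 : ℝ := (klExportPkg2 P R Q₀).2.1

/-- **The successor deferred coupling threshold `klCUu2 P R Q₀ Q cc`** — CE-aware: read at the whole raised package `Q` (DefsU11's `min` term
`klCUu2 P R (klEngQ7 P R) (QT P R) cc`). -/
def klCUu2 : EngConsts → ℝ → ℝ := (klExportPkg2 P R Q₀).2.2

/-- The successor deferred package is admissible (unconditionally). -/
theorem isExportPkg2_klExportPkg2 : IsExportPkg2 (klExportPkg2 P R Q₀) := by
  classical
  unfold klExportPkg2
  split_ifs with h
  · exact (Classical.choose_spec h).1
  · exact isExportPkg2_scaleZero Q₀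

/-- The successor deferred table is geometric with the deferred ratio (unconditionally). -/
theorem isGeomTable_klCU2 : IsGeomTable (klCU2 P R Q₀) (klCUA2 P R Q₀) := (isExportPkg2_klExportPkg2 P R Q₀).1

/-- `0 ≤ klCU2 P R Q₀ p`. -/
theorem klCU2_nonneg (p : ℕ) : 0 ≤ klCU2 P R Q₀ p := (isGeomTable_klCU2 P R Q₀).1 p

/-- `0 ≤ klCUA2 P R Q₀`. -/
theorem klCUA2_nonneg : 0 ≤ klCUA2 P R Q₀ := (isGeomTable_klCU2 P R Q₀).2.1

/-- `0 < klCUu2 P R Q₀ Q cc` (unconditionally) — so a `min` with it keeps a U-door positive. -/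
theorem klCUu2_pos (Q : EngConsts) (cc : ℝ) : 0 < klCUu2 P R Q₀ Q cc := (isExportPkg2_klExportPkg2 P R Q₀).2 Q cc

variable {P R Q₀}

/-- **The successor step holds for the deferred package as soon as it holds for some admissible package.** -/
theorem levelsUStep2_klCU2_of_exists (h : ∃ e : (ℕ → ℝ) × ℝ × (EngConsts → ℝ → ℝ), IsExportPkg2 e ∧ LevelsUStep2 P R Q₀ e.1 e.2.2) :
    LevelsUStep2 P R Q₀ (klCU2 P R Q₀) (klCUu2 P R Q₀) := by
  classical
  have hpkg : klExportPkg2 P R Q₀ = Classical.choose h := by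
    unfold klExportPkg2
    rw [dif_pos h]
  unfold klCU2 klCUu2
  rw [hpkg]
  exact (Classical.choose_spec h).2

/-- Packaging an explicit witness. -/
theorem levelsUStep2_klCU2_of {c : ℕ → ℝ} {A : ℝ} {u : EngConsts → ℝ → ℝ} (hg : IsGeomTable c A) (hu : ∀ Q cc, 0 < u Q cc)
    (hs : LevelsUStep2 P R Q₀ c u) : LevelsUStep2 P R Q₀ (klCU2 P R Q₀) (klCUu2 P R Q₀) :=
  levelsUStep2_klCU2_of_exists ⟨(c, A, u), ⟨hg, hu⟩, hs⟩

/-- **ELSE branch** ((P0′)/F*): with no admissible witness the successor package IS the scale-0 package. -/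
theorem klExportPkg2_of_not_exists (h : ¬ ∃ e : (ℕ → ℝ) × ℝ × (EngConsts → ℝ → ℝ), IsExportPkg2 e ∧ LevelsUStep2 P R Q₀ e.1 e.2.2) :
    klExportPkg2 P R Q₀ = (fun p => |Q₀.CE| ^ p, |Q₀.CE|, fun _ _ => 1) := by
  classical
  unfold klExportPkg2
  rw [dif_neg h]

/-- ELSE branch, table: `klCU2 P R Q₀ = fun p => |Q₀.CE|^p`. -/
theorem klCU2_of_not_exists (h : ¬ ∃ e : (ℕ → ℝ) × ℝ × (EngConsts → ℝ → ℝ), IsExportPkg2 e ∧ LevelsUStep2 P R Q₀ e.1 e.2.2) :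
    klCU2 P R Q₀ = fun p => |Q₀.CE| ^ p := by
  unfold klCU2
  rw [klExportPkg2_of_not_exists h]

/-- **Table domination in the ELSE branch**: `Q₀.CE^p ≤ klCU2 P R Q₀ p` (what the scale-0 base `levelsUExportAt_zero_klEng8` is fed with). -/
theorem pow_CE_le_klCU2_of_not_exists (h : ¬ ∃ e : (ℕ → ℝ) × ℝ × (EngConsts → ℝ → ℝ), IsExportPkg2 e ∧ LevelsUStep2 P R Q₀ e.1 e.2.2)
    (p : ℕ) : Q₀.CE ^ p ≤ klCU2 P R Q₀ p := by
  rw [klCU2_of_not_exists h]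
  calc Q₀.CE ^ p ≤ |Q₀.CE ^ p| := le_abs_self _
    _ = |Q₀.CE| ^ p := abs_pow _ _

end Deferred

end Summit.HubbardSuperconductivity.HubbardSuperconductivity.Theorems.KLRegimeSplit

end
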